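import Summits.Schanuel.Schanuel.Theorems.RootDecomp1AdditiveCells

/-!
# RootDecomp1 — ROUND 15 «AdditiveCells», part 2: item D on LW-saturated spans; the power-line cell of D₃

Continuation of `RootDecomp1AdditiveCells` (lens 1, gen 15; see that file's header for the lever, sources and port
notes).  This part serves item **D** = `DisjointSaturatedEssentialSchanuel` (stmt-Schanuel-30353):

* §5 `disjointSchanuel_of_lwSpan`, `disjointSaturatedEssentialSchanuel_lwSpan` — D decided at EVERY length on spans
  containing `n − 1` ℚ-free algebraic numbers, ANY remaining entry (item binders verbatim; `a = 1`, `v = n − 1`).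
* §6 the power-line cell `(w, w², w³)`, `w ∉ ℚ̄`: ℚ-free (`powerTriple_linearIndependent`), PLAIN — outside the
  E-stable stratum decided in round 14 (`powerTriple_plain`), argument degree `1` (`argDegree_powerTriple_le_one`,
  `one_le_argDegree_powerTriple`), and the REDUCTION `disjointSchanuel_powerTriple_iff`: under `ε = 0`, D₃ there ⟺
  `2 ≤ trdeg ℚ(e^w, e^{w²}, e^{w³})` — booked OPEN with its deciding input named (no instrument certifies two
  algebraically independent values on a non-E-stable 3-dimensional span; `NODE-g15.md` §3).

Port: `Summits/Schanuel/Schanuel/Theorems/RootDecomp1AdditiveCellsD.lean`, `--supports stmt-Schanuel-30353`.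
-/

set_option linter.dupNamespace false

noncomputable section

namespace Summit.Schanuel.Schanuel.Theorems.RootDecomp1AdditiveCellsD

open Complex IntermediateField Module Polynomial
open Literature.Barriers.Schanuel (gridExp gridField₂ gridField₂_def smallTrdeg_thm_2_9_two_two)
open Summit.Schanuel.Schanuel.Theorems.RootDecomp1EAnchor (isAlgebraic_of_mem_adjoin trdeg_adjoin_le_of_isAlgebraic
  trdeg_adjoin_le_nat trdeg_adjoin_union_le exists_nat_eq_of_le_natCast)
open Summit.Schanuel.Schanuel.Theorems.RootDecomp1EEStableRung (one_le_trdeg_adjoin_of_transcendental)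
open Summit.Schanuel.Schanuel.Theorems.RootDecomp1ArgumentCells (trdeg_vals_le
  trdeg_args_le_one_of_isAlgebraic_adjoin_singleton le_valDegree_of_exp_algebraic_mem)
open Summit.Schanuel.Schanuel.Theorems.RootDecomp1AdditiveCells (le_valDegree_of_lwSpan le_trdeg_of_additive_cert
  linearIndependent_mul_left)

/-! ## §5  ITEM D (`DisjointSaturatedEssentialSchanuel`, stmt-Schanuel-30353) ON LW-SATURATED SPANS, ANY LENGTH -/

/-- **SCHANUEL ON THE DISJOINT STRATUM for spans containing `n − 1` ℚ-free algebraic numbers, ANY head.**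
`z ⊂ ℚ̄`: Lindemann–Weierstrass outright; else `a = 1` (a transcendental entry) `+ v = n − 1` (LW in the span). -/
theorem disjointSchanuel_of_lwSpan {n : ℕ} (z : Fin n → ℂ) (hz : LinearIndependent ℚ z)
    {m : ℕ} (b : Fin m → ℂ) (hb : LinearIndependent ℚ b) (hbalg : ∀ j, IsAlgebraic ℚ (b j))
    (hmem : ∀ j, b j ∈ Submodule.span ℚ (Set.range z)) (hnm : n ≤ m + 1)
    (hsplit : Algebra.trdeg ℚ ↥(adjoin ℚ (Set.range z)) + Algebra.trdeg ℚ ↥(adjoin ℚ (Set.range (cexp ∘ z))) ≤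
      Algebra.trdeg ℚ ↥(adjoin ℚ (Set.range z ∪ Set.range (cexp ∘ z)))) :
    (n : Cardinal) ≤ Algebra.trdeg ℚ ↥(adjoin ℚ (Set.range z ∪ Set.range (cexp ∘ z))) := by
  by_cases h0 : ∀ i, IsAlgebraic ℚ (z i)
  · have h3 : (n : Cardinal) ≤ Algebra.trdeg ℚ ↥(adjoin ℚ (Set.range (cexp ∘ z))) :=
      le_valDegree_of_exp_algebraic_mem z z h0 hz fun j => subset_adjoin ℚ _ ⟨j, rfl⟩
    exact h3.trans (trdeg_vals_le z)
  · obtain ⟨i, hi⟩ := not_forall.mp h0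
    have h1 : (1 : Cardinal) ≤ Algebra.trdeg ℚ ↥(adjoin ℚ (Set.range z)) :=
      one_le_trdeg_adjoin_of_transcendental hi ⟨i, rfl⟩
    exact le_trdeg_of_additive_cert z (a := 1) (by simpa using h1) (le_valDegree_of_lwSpan z b hb hbalg hmem) hsplit
      (by omega)

/-- **D₃-CELL «argument-rich» (bidegree certificate `(2,1)`)**: two algebraically independent ARGUMENTS in `ℚ(z)`
(members mod the tree theorem `nesterenko`: triples through `π, e^π` — lens 2's period-rich engine, which read the
TOTAL degree for item B₃) plus one transcendental VALUE give, under the split, item D's conclusion at `n = 3`. -/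
theorem disjointSchanuel_three_cell_argRich (z : Fin 3 → ℂ) {u : Fin 2 → ℂ}
    (hu : AlgebraicIndependent ℚ u) (humem : ∀ j, u j ∈ adjoin ℚ (Set.range z))
    (hv : ∃ i, Transcendental ℚ (cexp (z i)))
    (hsplit : Algebra.trdeg ℚ ↥(adjoin ℚ (Set.range z)) + Algebra.trdeg ℚ ↥(adjoin ℚ (Set.range (cexp ∘ z))) ≤
      Algebra.trdeg ℚ ↥(adjoin ℚ (Set.range z ∪ Set.range (cexp ∘ z)))) :
    ((3 : ℕ) : Cardinal) ≤ Algebra.trdeg ℚ ↥(adjoin ℚ (Set.range z ∪ Set.range (cexp ∘ z))) := by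
  obtain ⟨i, hi⟩ := hv
  have ha : ((2 : ℕ) : Cardinal) ≤ Algebra.trdeg ℚ ↥(adjoin ℚ (Set.range z)) :=
    Summit.Schanuel.Schanuel.Theorems.RootDecomp1ArgumentCells.le_trdeg_of_algebraicIndependent_mem _ hu humem
  have hv1 : (1 : Cardinal) ≤ Algebra.trdeg ℚ ↥(adjoin ℚ (Set.range (cexp ∘ z))) :=
    one_le_trdeg_adjoin_of_transcendental hi ⟨i, rfl⟩
  exact le_trdeg_of_additive_cert z (v := 1) ha (by simpa using hv1) hsplit (by omega)

/-- **RUNG = item D RESTRICTED TO LW-SATURATED SPANS** (the cell «`span_ℚ z` contains `n − 1` ℚ-free algebraic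
numbers» inserted after `LinearIndependent ℚ z`; all other binders of stmt-Schanuel-30353 VERBATIM and unused
except the split).  Decides D at EVERY length on this cell — the any-base completion of the round-6 `logCons`
calibration cell `(log α | b)`; for a transcendental head the span is PLAIN (no irrational algebraic multiplier), so
the cell is disjoint from round 14's E-stable stratum. -/
theorem disjointSaturatedEssentialSchanuel_lwSpan :
    ∀ (n : ℕ), 3 ≤ n → ∀ (z : Fin n → ℂ), LinearIndependent ℚ z →
      (∃ (m : ℕ) (b : Fin m → ℂ), n ≤ m + 1 ∧ LinearIndependent ℚ b ∧ (∀ j, IsAlgebraic ℚ (b j)) ∧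
        ∀ j, b j ∈ Submodule.span ℚ (Set.range z)) →
      (∀ i, z i ∈ Literature.NumberTheory.Transcendental.ecl (∅ : Set ℂ)) →
      (∀ (m : ℕ), m < n → ∀ (w : Fin m → ℂ), LinearIndependent ℚ w →
        (∀ i, w i ∈ Submodule.span ℚ (Set.range z)) →
        (m : Cardinal) ≤ Algebra.trdeg ℚ ↥(IntermediateField.adjoin ℚ (Set.range w ∪ Set.range (Complex.exp ∘ w)))) →
      (∀ w : ℂ, IsAlgebraic ↥(IntermediateField.adjoin ℚ (Set.range z ∪ Set.range (Complex.exp ∘ z))) w →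
        IsAlgebraic ↥(IntermediateField.adjoin ℚ (Set.range z ∪ Set.range (Complex.exp ∘ z))) (Complex.exp w) →
        w ∈ Submodule.span ℚ (Set.range z)) →
      (∀ (k : ℕ) (t : Fin k → ℂ) (β₀ γ₀ : Fin n → ℂ) (β γ : Fin n → Fin k → ℂ), (∀ i, IsAlgebraic ℚ (β₀ i)) →
        (∀ i j, IsAlgebraic ℚ (β i j)) → (∀ i, IsAlgebraic ℚ (γ₀ i)) → (∀ i j, IsAlgebraic ℚ (γ i j)) →
        (∀ i, z i = β₀ i + ∑ j, β i j * t j) → (∀ i, Complex.exp (z i) = γ₀ i + ∑ j, γ i j * t j) → n ≤ k) →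
      (∀ (k : ℕ) (t : Fin k → ℂ) (β₀ γ₀ : Fin n → ℂ) (β γ : Fin n → Fin k → ℂ) (δ ε : Fin n → Fin k → Fin k → ℂ),
        (∀ i, IsAlgebraic ℚ (β₀ i)) → (∀ i j, IsAlgebraic ℚ (β i j)) → (∀ i j j', IsAlgebraic ℚ (δ i j j')) →
        (∀ i, IsAlgebraic ℚ (γ₀ i)) → (∀ i j, IsAlgebraic ℚ (γ i j)) → (∀ i j j', IsAlgebraic ℚ (ε i j j')) →
        (∀ i, z i = β₀ i + ∑ j, β i j * t j + ∑ j, ∑ j', δ i j j' * (t j * t j')) →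
        (∀ i, Complex.exp (z i) = γ₀ i + ∑ j, γ i j * t j + ∑ j, ∑ j', ε i j j' * (t j * t j')) → n ≤ k) →
      (∀ (k : ℕ) (t : Fin k → ℂ) (D : MvPolynomial (Fin k) ℂ) (N E : Fin n → MvPolynomial (Fin k) ℂ),
        (∀ m, IsAlgebraic ℚ (MvPolynomial.coeff m D)) → (∀ i m, IsAlgebraic ℚ (MvPolynomial.coeff m (N i))) →
        (∀ i m, IsAlgebraic ℚ (MvPolynomial.coeff m (E i))) → MvPolynomial.eval t D ≠ 0 →
        (∀ i, z i * MvPolynomial.eval t D = MvPolynomial.eval t (N i)) →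
        (∀ i, Complex.exp (z i) * MvPolynomial.eval t D = MvPolynomial.eval t (E i)) → n ≤ k) →
      (Algebra.trdeg ℚ ↥(IntermediateField.adjoin ℚ (Set.range z)) +
          Algebra.trdeg ℚ ↥(IntermediateField.adjoin ℚ (Set.range (Complex.exp ∘ z))) ≤
        Algebra.trdeg ℚ ↥(IntermediateField.adjoin ℚ (Set.range z ∪ Set.range (Complex.exp ∘ z)))) →
      (n : Cardinal) ≤ Algebra.trdeg ℚ ↥(IntermediateField.adjoin ℚ (Set.range z ∪ Set.range (Complex.exp ∘ z))) := by
  intro n _ z hz hcell _ _ _ _ _ _ hsplit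
  obtain ⟨m, b, hnm, hb, hbalg, hmem⟩ := hcell
  exact disjointSchanuel_of_lwSpan z hz b hb hbalg hmem hnm hsplit

/-! ## §6  THE FIRST CELL OF D₃ OUTSIDE THE E-STABLE STRATUM: power lines `(w, w², w³)`, `w ∉ ℚ̄` -/

/-- The power triple `(w, w², w³)`. -/
def powerTriple (w : ℂ) : Fin 3 → ℂ := ![w, w ^ 2, w ^ 3]

/-- `powerTriple w 0 = w`. -/
@[simp] theorem powerTriple_zero (w : ℂ) : powerTriple w 0 = w := rfl
/-- `powerTriple w 1 = w ^ 2`. -/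
@[simp] theorem powerTriple_one (w : ℂ) : powerTriple w 1 = w ^ 2 := rfl
/-- `powerTriple w 2 = w ^ 3`. -/
@[simp] theorem powerTriple_two (w : ℂ) : powerTriple w 2 = w ^ 3 := rfl

/-- A transcendental number is non-zero. -/
private theorem ne_zero_of_transcendental {w : ℂ} (hw : Transcendental ℚ w) : w ≠ 0 := by
  rintro rfl
  exact hw isAlgebraic_zero

/-- Membership in `span_ℚ (w, w², w³)` in coordinates. -/
theorem mem_span_powerTriple_iff {w v : ℂ} :
    v ∈ Submodule.span ℚ (Set.range (powerTriple w)) ↔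
      ∃ c : Fin 3 → ℚ, (c 0 : ℂ) * w + (c 1 : ℂ) * w ^ 2 + (c 2 : ℂ) * w ^ 3 = v := by
  rw [Submodule.mem_span_range_iff_exists_fun]
  refine exists_congr fun c => ?_
  simp [Fin.sum_univ_three, Rat.smul_def]

/-- **`(w, w², w³)` IS ℚ-FREE for `w ∉ ℚ̄`.** -/
theorem powerTriple_linearIndependent {w : ℂ} (hw : Transcendental ℚ w) : LinearIndependent ℚ (powerTriple w) := by
  rw [Fintype.linearIndependent_iff]
  intro g hg
  have hsum : (g 0 : ℂ) * w + (g 1 : ℂ) * w ^ 2 + (g 2 : ℂ) * w ^ 3 = 0 := by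
    simpa [Fin.sum_univ_three, Rat.smul_def] using hg
  set p : ℚ[X] := C (g 0) * X ^ 1 + C (g 1) * X ^ 2 + C (g 2) * X ^ 3 with hp
  have hpw : aeval w p = 0 := by
    simp only [hp, map_add, map_mul, aeval_C, map_pow, aeval_X, eq_ratCast, pow_one]
    exact hsum
  have hp0 : p = 0 := (transcendental_iff.mp hw) p hpw
  have hc : ∀ k : ℕ, p.coeff k = 0 := fun k => by rw [hp0, coeff_zero]
  have h0 := hc 1
  have h1 := hc 2
  have h2 := hc 3
  simp only [hp, coeff_add, coeff_C_mul_X_pow] at h0 h1 h2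
  norm_num at h0 h1 h2
  intro i
  fin_cases i
  · exact h0
  · exact h1
  · exact h2

/-- **`(w, w², w³)` IS PLAIN for `w ∉ ℚ̄`**: every multiplier of its ℚ-span is RATIONAL — in particular the span has
no irrational algebraic multiplier, i.e. the power triple lies OUTSIDE round 14's E-stable stratum. -/
theorem powerTriple_plain {w : ℂ} (hw : Transcendental ℚ w) {β : ℂ}
    (hβ : ∀ i, β * powerTriple w i ∈ Submodule.span ℚ (Set.range (powerTriple w))) :
    β ∈ Set.range (algebraMap ℚ ℂ) := by
  have hw0 : w ≠ 0 := ne_zero_of_transcendental hw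
  obtain ⟨c, hc⟩ := mem_span_powerTriple_iff.mp (hβ 0)
  obtain ⟨d, hd⟩ := mem_span_powerTriple_iff.mp (hβ 2)
  simp only [powerTriple_zero, powerTriple_two] at hc hd
  -- `β = c₀ + c₁ w + c₂ w²`, and `β w³ = d₀ w + d₁ w² + d₂ w³`
  have hβ' : β = (c 0 : ℂ) + (c 1 : ℂ) * w + (c 2 : ℂ) * w ^ 2 := by
    have : ((c 0 : ℂ) + (c 1 : ℂ) * w + (c 2 : ℂ) * w ^ 2) * w = β * w := by rw [← hc]; ring
    exact (mul_right_cancel₀ hw0 this).symm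
  have hrel : (d 0 : ℂ) * w + (d 1 : ℂ) * w ^ 2 + ((d 2 : ℂ) - (c 0 : ℂ)) * w ^ 3 - (c 1 : ℂ) * w ^ 4
      - (c 2 : ℂ) * w ^ 5 = 0 := by
    rw [hβ'] at hd
    linear_combination hd
  set p : ℚ[X] := C (d 0) * X ^ 1 + C (d 1) * X ^ 2 + C (d 2 - c 0) * X ^ 3 - C (c 1) * X ^ 4 - C (c 2) * X ^ 5
    with hp
  have hpw : aeval w p = 0 := by
    simp only [hp, map_add, map_sub, map_mul, aeval_C, map_pow, aeval_X, eq_ratCast, pow_one]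
    exact hrel
  have hp0 : p = 0 := (transcendental_iff.mp hw) p hpw
  have hcoef : ∀ k : ℕ, p.coeff k = 0 := fun k => by rw [hp0, coeff_zero]
  have h4 := hcoef 4
  have h5 := hcoef 5
  simp only [hp, coeff_add, coeff_sub, coeff_C_mul_X_pow] at h4 h5
  norm_num at h4 h5
  refine ⟨c 0, ?_⟩
  rw [hβ', h4, h5]
  simp

/-- **ARGUMENT DEGREE OF A POWER LINE = 1**: `trdeg ℚ(w, w², w³) ≤ 1` (all inside `ℚ(w)`) … -/
theorem argDegree_powerTriple_le_one (w : ℂ) :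
    Algebra.trdeg ℚ ↥(adjoin ℚ (Set.range (powerTriple w))) ≤ 1 := by
  refine trdeg_args_le_one_of_isAlgebraic_adjoin_singleton (powerTriple w) w fun i => ?_
  refine isAlgebraic_of_mem_adjoin ?_
  fin_cases i
  · simpa using mem_adjoin_simple_self ℚ w
  · simpa using pow_mem (mem_adjoin_simple_self ℚ w) 2
  · simpa using pow_mem (mem_adjoin_simple_self ℚ w) 3

/-- … and `1 ≤ trdeg ℚ(w, w², w³)` for `w ∉ ℚ̄`. -/
theorem one_le_argDegree_powerTriple {w : ℂ} (hw : Transcendental ℚ w) :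
    (1 : Cardinal) ≤ Algebra.trdeg ℚ ↥(adjoin ℚ (Set.range (powerTriple w))) :=
  one_le_trdeg_adjoin_of_transcendental hw ⟨0, rfl⟩

/-- `(1, w)` is ℚ-free for `w ∉ ℚ̄`. -/
theorem pair_one_linearIndependent {w : ℂ} (hw : Transcendental ℚ w) : LinearIndependent ℚ ![(1 : ℂ), w] := by
  rw [LinearIndependent.pair_iff]
  intro s t hst
  have h : (s : ℂ) + (t : ℂ) * w = 0 := by simpa [Rat.smul_def] using hst
  by_cases ht : t = 0
  · subst ht
    have hs : (s : ℂ) = 0 := by simpa using h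
    exact ⟨by exact_mod_cast hs, rfl⟩
  · exfalso
    have htC : (t : ℂ) ≠ 0 := by exact_mod_cast ht
    apply hw
    have hw' : w = ((-s / t : ℚ) : ℂ) := by
      rw [Rat.cast_div, Rat.cast_neg, eq_div_iff htC]
      linear_combination h
    rw [hw']
    exact isAlgebraic_algebraMap (-s / t)

/-- `(w, w²)` is ℚ-free for `w ∉ ℚ̄`. -/
theorem pair_sq_linearIndependent {w : ℂ} (hw : Transcendental ℚ w) : LinearIndependent ℚ ![w, w ^ 2] := by
  have h := linearIndependent_mul_left (pair_one_linearIndependent hw) (ne_zero_of_transcendental hw)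
  have e : (fun i => w * (![(1 : ℂ), w] : Fin 2 → ℂ) i) = ![w, w ^ 2] := by
    funext i
    fin_cases i <;> simp [pow_two]
  rwa [e] at h

/-- **THE CERTIFIED FLOOR OF THE POWER-LINE CELL: `1 ≤ trdeg ℚ(e^w, e^{w²}, e^{w³})` for every `w ∉ ℚ̄`**
(Brownawell–Waldschmidt = the «Moreover» clause of Theorem 2.9 for `d = ℓ = 2`, tree theorem
`smallTrdeg_thm_2_9_two_two_holds`, on `x = (1, w)`, `y = (w, w²)`: if `e^w, e^{w²} ∈ ℚ̄` then
`trdeg ℚ(w, e^{w³}) ≥ 2`; so at least one of `e^w, e^{w²}, e^{w³}` is transcendental — the `e^e`-or-`e^{e²}`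
phenomenon).  This is ALL the (2,2) instruments give here: D₃ needs `2` (`disjointSchanuel_powerTriple_iff`). -/
theorem one_le_valDegree_powerTriple (h22 : smallTrdeg_thm_2_9_two_two) {w : ℂ} (hw : Transcendental ℚ w) :
    (1 : Cardinal) ≤ Algebra.trdeg ℚ ↥(adjoin ℚ (Set.range (cexp ∘ powerTriple w))) := by
  suffices h : ∃ i, Transcendental ℚ (cexp (powerTriple w i)) by
    obtain ⟨i, hi⟩ := h
    exact one_le_trdeg_adjoin_of_transcendental hi ⟨i, rfl⟩
  by_contra hall
  simp only [not_exists, Transcendental, not_not] at hall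
  have h1 : IsAlgebraic ℚ (cexp w) := by simpa using hall 0
  have h2 : IsAlgebraic ℚ (cexp (w ^ 2)) := by simpa using hall 1
  have h3 : IsAlgebraic ℚ (cexp (w ^ 3)) := by simpa using hall 2
  set x : Fin 2 → ℂ := ![(1 : ℂ), w] with hx
  set y : Fin 2 → ℂ := ![w, w ^ 2] with hy
  have h2le : (2 : Cardinal) ≤ Algebra.trdeg ℚ ↥(gridField₂ x y) :=
    h22 x y (pair_one_linearIndependent hw) (pair_sq_linearIndependent hw) (by simpa [hx, hy] using h1)
      (by simpa [hx, hy] using h2)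
  -- but `ℚ(x, y, e^{x_i y_j}) = ℚ(w, e^w, e^{w²}, e^{w³})` is algebraic over `ℚ(w)`: `trdeg ≤ 1`
  set K : IntermediateField ℚ ℂ := adjoin ℚ ({w} : Set ℂ) with hK
  have hwK : w ∈ K := mem_adjoin_simple_self ℚ w
  have hle : Algebra.trdeg ℚ ↥(gridField₂ x y) ≤ 1 := by
    rw [gridField₂_def]
    refine (trdeg_adjoin_le_of_isAlgebraic (K := K) ?_).trans
      (trdeg_adjoin_le_nat (F := ℚ) ({w} : Set ℂ) (n := 1) (by simp))
    rintro t ((⟨i, rfl⟩ | ⟨j, rfl⟩) | ⟨p, rfl⟩)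
    · fin_cases i
      · simpa [hx] using (isAlgebraic_one : IsAlgebraic ↥K (1 : ℂ))
      · simpa [hx] using isAlgebraic_of_mem_adjoin hwK
    · fin_cases j
      · simpa [hy] using isAlgebraic_of_mem_adjoin hwK
      · simpa [hy] using isAlgebraic_of_mem_adjoin (pow_mem hwK 2)
    · obtain ⟨i, j⟩ := p
      show IsAlgebraic ↥K (cexp (x i * y j))
      fin_cases i <;> fin_cases j
      · simpa [hx, hy] using h1.tower_top (L := ↥K)
      · simpa [hx, hy] using h2.tower_top (L := ↥K)
      · have e : w * w = w ^ 2 := by ring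
        simpa [hx, hy, e] using h2.tower_top (L := ↥K)
      · have e : w * w ^ 2 = w ^ 3 := by ring
        simpa [hx, hy, e] using h3.tower_top (L := ↥K)
  have h21 : (2 : Cardinal) ≤ 1 := h2le.trans hle
  norm_num at h21

/-- **THE REDUCTION.**  For `w ∉ ℚ̄`, under the split `ε = 0`, item D's conclusion at the power triple,
`3 ≤ trdeg ℚ(w, w², w³, e^w, e^{w²}, e^{w³})`, is EQUIVALENT to the pure value statement
`2 ≤ trdeg ℚ(e^w, e^{w²}, e^{w³})` («PowerValueTwo(w)»).  No instrument in the tree certifies the right-hand side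
for a single `w` (instrument card, `NODE-g15.md` §3): this is the first cell of D₃ outside the E-stable stratum,
booked OPEN with its deciding input named. -/
theorem disjointSchanuel_powerTriple_iff {w : ℂ} (hw : Transcendental ℚ w)
    (hsplit : Algebra.trdeg ℚ ↥(adjoin ℚ (Set.range (powerTriple w))) +
        Algebra.trdeg ℚ ↥(adjoin ℚ (Set.range (cexp ∘ powerTriple w))) ≤
      Algebra.trdeg ℚ ↥(adjoin ℚ (Set.range (powerTriple w) ∪ Set.range (cexp ∘ powerTriple w)))) :
    ((3 : ℕ) : Cardinal) ≤
        Algebra.trdeg ℚ ↥(adjoin ℚ (Set.range (powerTriple w) ∪ Set.range (cexp ∘ powerTriple w))) ↔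
      (2 : Cardinal) ≤ Algebra.trdeg ℚ ↥(adjoin ℚ (Set.range (cexp ∘ powerTriple w))) := by
  set t₁ := Algebra.trdeg ℚ ↥(adjoin ℚ (Set.range (powerTriple w))) with ht₁
  set t₂ := Algebra.trdeg ℚ ↥(adjoin ℚ (Set.range (cexp ∘ powerTriple w))) with ht₂
  have h1 : t₁ ≤ 1 := argDegree_powerTriple_le_one w
  have h1' : (1 : Cardinal) ≤ t₁ := one_le_argDegree_powerTriple hw
  have h2fin : t₂ ≤ ((3 : ℕ) : Cardinal) :=
    trdeg_adjoin_le_nat (F := ℚ) _ (Cardinal.mk_range_le.trans (by simp))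
  obtain ⟨m, hm, hm3⟩ := exists_nat_eq_of_le_natCast h2fin
  constructor
  · intro h3
    have hle : ((3 : ℕ) : Cardinal) ≤ t₂ + t₁ := h3.trans (trdeg_adjoin_union_le _ _)
    have hle' : ((3 : ℕ) : Cardinal) ≤ (m : Cardinal) + ((1 : ℕ) : Cardinal) := by
      refine hle.trans ?_
      rw [hm]
      exact add_le_add (le_refl _) (by simpa using h1)
    have h2m : 2 ≤ m := by
      have : ((3 : ℕ) : Cardinal) ≤ ((m + 1 : ℕ) : Cardinal) := by push_cast at hle' ⊢; exact hle'
      have := Nat.cast_le.mp this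
      omega
    rw [hm]
    exact_mod_cast h2m
  · intro h2
    have : (1 : Cardinal) + 2 ≤ _ := (add_le_add h1' h2).trans hsplit
    have e : ((3 : ℕ) : Cardinal) = (1 : Cardinal) + 2 := by norm_num
    rw [e]
    exact this

end Summit.Schanuel.Schanuel.Theorems.RootDecomp1AdditiveCellsD

end
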